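import Summits.NavierStokesRegularity.NavierStokesRegularity.Theorems.LerayQuarterDissipationFiniteDissipationLiouvilleTraceEpsilon
import Summits.NavierStokesRegularity.NavierStokesRegularity.Theorems.LerayQuarterDissipationFiniteDissipationLiouvilleFarField
import Literature.Analysis.FluidPDE.NSBoundedHigherRegularityQuant
import HarnessLib

/-!
# Crux `FiniteDissipationLiouville` (stmt-NavierStokesRegularity-22144): OFF ITS SINGULAR SET THE
# FINAL DATUM OF A MEMBER OF THE STRATUM IS A CONTINUOUS FIELD, ATTAINED LOCALLY UNIFORMLY AT A
# HÖLDER RATE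

Theorems file of route `LerayQuarterDissipation` (lead prover g5; `--supports` the crux: structure
of the final datum of EVERY member near its regular points; with `…TraceSingularSet` it completes
the description "final-time singular set = singular support of the final datum"). Navier–Stokes
regularity is NOT proved by anything here; no summit is.

`𝒟_{C,K}`: Type-I ancient mild fields `u` (`IsTypeIAncientMild C u`) with the quarter-rate law;
`T_u(ψ) = lim_{t→0⁻} ∫⟪u(t), ψ⟫` its distributional trace (lead g3). At a REGULAR point `a` (the
crux's singular clause fails at `a`: `u` is bounded on some backward cylinder
`Q = (−ρ², 0) × B(a, ρ)`) the tree's PROVED higher-regularity theorem for bounded distributional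
solutions (`NSBoundedHigherRegularityBounds_holds`, Seregin–Šverák 2009 §2 / Seregin 2014
Prop. 3.10: with the pressure in `L^{3/2}(Q)` — here lead g3's gauged pressure,
`exists_normalised_pressure` — every spatial derivative is HÖLDER CONTINUOUS IN SPACE-TIME on the
smaller cylinders, uniformly up to the top time) makes `u` uniformly Hölder in time on
`(−r², 0) × B(a, r)`; hence:

* `exists_finalDatum_near_regular` — **near a regular point the final datum is a CONTINUOUS field
  `U₀`, attained UNIFORMLY at a Hölder rate**: there are `r > 0`, a field `U₀` continuous on
  `B(a, r)`, and `M, α > 0` with `‖u(t, x) − U₀(x)‖ ≤ M (−t)^α` for all `t ∈ (−r², 0)`,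
  `x ∈ B(a, r)`; and `U₀` IS the trace there: `∫⟪u(t), ψ⟫ → ∫⟪U₀, ψ⟫` for every test field `ψ`
  supported in `B(a, r)`.
* With `singularAt_iff_trace_unbounded_near` (`…TraceSingularSet`) and `exists_finite_singularSet`
  (lead g4): **the final datum of a member of `𝒟_{C,K}` is a continuous field on the complement of
  its at most `c(K⁺)³` singular points, to which `u(t, ·)` converges locally uniformly as
  `t → 0⁻`, and it is locally unbounded at each singular point** — the picture of the homogeneous
  DSS data `a(x̂)|x|⁻¹` (smooth off the origin), for every member, wandering ones included.

References: G. Seregin, V. Šverák, arXiv:0804.1803, §2; G. Seregin, *Lecture notes on regularity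
theory for the Navier–Stokes equations* (2014), Prop. 3.10; Caffarelli–Kohn–Nirenberg 1982.
-/

noncomputable section

-- the summit and its single sub-problem share the name (CONVENTIONS §1), as in every Theorems file
set_option linter.dupNamespace false

namespace Summit.NavierStokesRegularity.NavierStokesRegularity.Theorems.FiniteDissipationLiouville.Birth.Apex

open MeasureTheory Set Filter Topology Metric Function TopologicalSpace
open Literature.Analysis Literature.Analysis.FluidPDE
open scoped ENNReal NNReal RealInnerProductSpace

variable {C K : ℝ} {u : ℝ → EuclideanSpace ℝ (Fin 3) → EuclideanSpace ℝ (Fin 3)}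

/-- `dist` of `0`-th iterated derivatives is `dist` of the values. -/
theorem dist_iteratedFDeriv_zero (f g : EuclideanSpace ℝ (Fin 3) → EuclideanSpace ℝ (Fin 3))
    (x y : EuclideanSpace ℝ (Fin 3)) :
    dist (iteratedFDeriv ℝ 0 f x) (iteratedFDeriv ℝ 0 g y) = dist (f x) (g y) := by
  rw [dist_eq_norm, dist_eq_norm]
  have e : iteratedFDeriv ℝ 0 f x - iteratedFDeriv ℝ 0 g y =
      iteratedFDeriv ℝ 0 (fun _ : EuclideanSpace ℝ (Fin 3) => f x - g y) x := by
    ext m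
    simp [iteratedFDeriv_zero_apply]
  rw [e, norm_iteratedFDeriv_zero]

/-! ### A Hölder-in-time representative near a regular point -/

/-- **Uniform Hölder continuity in time near a regular point.** If `u ∈ 𝒟_{C,K}` is bounded on the
backward cylinder `(−ρ², 0) × B(a, ρ)`, then for `r = ρ/2` there are `M ≥ 0` and `α > 0` with
`‖u(t, x) − u(s, x)‖ ≤ M |t − s|^α` for all `t, s ∈ (−r², 0)` and `x ∈ B(a, r)`
(`NSBoundedHigherRegularityBounds_holds` on the cylinder, with lead g3's `L^{3/2}` pressure; the
Hölder representative coincides with the continuous `u` on the open cylinder). -/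
theorem exists_holder_time_near_regular (hu : IsTypeIAncientMild C u)
    (hlaw : ∀ s : ℝ, s < 0 → ∫⁻ x, ‖fderiv ℝ (u s) x‖ₑ ^ 2 ≤ ENNReal.ofReal (K / Real.sqrt (-s)))
    {a : EuclideanSpace ℝ (Fin 3)} {ρ B : ℝ} (hρ : 0 < ρ)
    (hB : ∀ t ∈ Ioo (-(ρ ^ 2)) (0 : ℝ), ∀ x ∈ ball a ρ, ‖u t x‖ ≤ B) :
    ∃ M α : ℝ, 0 ≤ M ∧ 0 < α ∧ ∀ t ∈ Ioo (-((ρ / 2) ^ 2)) (0 : ℝ), ∀ s ∈ Ioo (-((ρ / 2) ^ 2)) (0 : ℝ),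
      ∀ x ∈ ball a (ρ / 2), ‖u t x - u s x‖ ≤ M * |t - s| ^ α := by
  -- ### the pressure and the distributional equations on the cylinder `Q((0,a), ρ)`
  obtain ⟨p, hsol, hpint⟩ := exists_normalised_pressure hu hlaw
  set z : ℝ × EuclideanSpace ℝ (Fin 3) := ((0 : ℝ), a) with hz
  have hQeq : parabolicCylinder ρ z = Ioo (-(ρ ^ 2)) (0 : ℝ) ×ˢ ball a ρ := by
    rw [parabolicCylinder, hz]
    simp only [zero_sub]
  have hle : parabolicCylinderOpens ρ z ≤ slab (EuclideanSpace ℝ (Fin 3)) (Iio 0) isOpen_Iio := by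
    intro w hw
    have hw' : w ∈ parabolicCylinder ρ z := hw
    rw [hQeq] at hw'
    exact mem_slab.2 hw'.1.2
  obtain ⟨hsws, -⟩ := FrequencyRigidity.ScaledEnergySplit.stub_classicalSuitableSlab u p hsol
  have hdist : IsDistributionalNSSolutionOn (parabolicCylinderOpens ρ z) 1 0 u p :=
    hsws.distributional.of_le hle
  -- ### the a.e. bound and the pressure bound on the cylinder
  have hmeasQ : MeasurableSet (parabolicCylinder ρ z) := (isOpen_parabolicCylinder ρ z).measurableSet
  have hbd : ∀ᵐ w ∂(volume.restrict (parabolicCylinder ρ z)), ‖u w.1 w.2‖ ≤ B := by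
    refine ae_restrict_of_forall_mem hmeasQ fun w hw => ?_
    rw [hQeq] at hw
    exact hB w.1 hw.1 w.2 hw.2
  have hsubQ : parabolicCylinder ρ z ⊆ Ioo (-(ρ ^ 2)) (0 : ℝ) ×ˢ ball (0 : EuclideanSpace ℝ (Fin 3)) (‖a‖ + ρ) := by
    rw [hQeq]
    refine prod_mono Subset.rfl fun x hx => ?_
    rw [mem_ball_zero_iff]
    rw [mem_ball, dist_eq_norm] at hx
    calc ‖x‖ = ‖(x - a) + a‖ := by rw [sub_add_cancel]
      _ ≤ ‖x - a‖ + ‖a‖ := norm_add_le _ _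
      _ < ρ + ‖a‖ := by linarith
      _ = ‖a‖ + ρ := add_comm _ _
  have hPfin : ∫⁻ w in parabolicCylinder ρ z, ‖p w.1 w.2‖ₑ ^ (3 / 2 : ℝ) < ⊤ :=
    lt_of_le_of_lt (lintegral_mono_set hsubQ) (hpint (ρ ^ 2) (‖a‖ + ρ) (by positivity) (by positivity))
  set P : ℝ≥0 := (∫⁻ w in parabolicCylinder ρ z, ‖p w.1 w.2‖ₑ ^ (3 / 2 : ℝ)).toNNReal with hPdef
  have hP : ∫⁻ w in parabolicCylinder ρ z, ‖p w.1 w.2‖ₑ ^ (3 / 2 : ℝ) ≤ P := by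
    rw [hPdef, ENNReal.coe_toNNReal hPfin.ne]
  -- ### the higher-regularity representative
  obtain ⟨Kf, Cf, αf, hα, hfact⟩ := NSBoundedHigherRegularityBounds_holds ρ B P
  obtain ⟨V, hae, -, hreg⟩ := hfact u p z hdist hbd hP
  set r : ℝ := ρ / 2 with hr
  have hr0 : 0 < r := by positivity
  have hrρ : r ∈ Ioo 0 ρ := ⟨hr0, by rw [hr]; linarith⟩
  obtain ⟨hHolder, -⟩ := hreg 0 r hrρ
  have hα0 : 0 < αf 0 r := hα 0 r hrρ
  -- the sub-cylinder `Q((0,a), r)`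
  have hQr : parabolicCylinder r z = Ioo (-(r ^ 2)) (0 : ℝ) ×ˢ ball a r := by
    rw [parabolicCylinder, hz]
    simp only [zero_sub]
  have hQrQ : parabolicCylinder r z ⊆ parabolicCylinder ρ z := by
    rw [hQr, hQeq]
    refine prod_mono (Ioo_subset_Ioo (by nlinarith [hrρ.2, hr0]) le_rfl) (ball_subset_ball hrρ.2.le)
  -- ### `V = u` on the open sub-cylinder (both continuous, equal a.e.)
  have hVcont : ContinuousOn (uncurry V) (parabolicCylinder r z) := by
    rw [Metric.continuousOn_iff]
    intro w hw ε hε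
    have hC1 : 0 < (Cf 0 r : ℝ) + 1 := by positivity
    have hα0' : (0 : ℝ) < (αf 0 r : ℝ) := by exact_mod_cast hα0
    set δ : ℝ := (ε / ((Cf 0 r : ℝ) + 1)) ^ (1 / (αf 0 r : ℝ)) with hδ
    have hδ0 : 0 < δ := Real.rpow_pos_of_pos (div_pos hε hC1) _
    refine ⟨δ, hδ0, fun w' hw' hww' => ?_⟩
    have h := hHolder.dist_le hw' hw
    rw [dist_iteratedFDeriv_zero] at h
    show dist (V w'.1 w'.2) (V w.1 w.2) < ε
    have h1 : dist w' w ^ (αf 0 r : ℝ) < δ ^ (αf 0 r : ℝ) :=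
      Real.rpow_lt_rpow dist_nonneg hww' hα0'
    have h2 : δ ^ (αf 0 r : ℝ) = ε / ((Cf 0 r : ℝ) + 1) := by
      rw [hδ, ← Real.rpow_mul (div_pos hε hC1).le, one_div_mul_cancel hα0'.ne', Real.rpow_one]
    calc dist (V w'.1 w'.2) (V w.1 w.2) ≤ (Cf 0 r : ℝ) * dist w' w ^ (αf 0 r : ℝ) := h
      _ ≤ ((Cf 0 r : ℝ) + 1) * dist w' w ^ (αf 0 r : ℝ) :=
          mul_le_mul_of_nonneg_right (by linarith) (Real.rpow_nonneg dist_nonneg _)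
      _ < ((Cf 0 r : ℝ) + 1) * δ ^ (αf 0 r : ℝ) := mul_lt_mul_of_pos_left h1 hC1
      _ = ε := by rw [h2]; field_simp
  have hucont : ContinuousOn (uncurry u) (parabolicCylinder r z) := by
    refine hu.continuousOn_uncurry.mono ?_
    rw [hQr]
    exact prod_mono (fun t ht => ht.2) (subset_univ _)
  have hVu : ∀ w ∈ parabolicCylinder r z, V w.1 w.2 = u w.1 w.2 := by
    have hae' : ∀ᵐ w ∂(volume.restrict (parabolicCylinder r z)),
        ‖(uncurry u - uncurry V) w‖ ≤ 0 := by
      filter_upwards [ae_restrict_of_ae_restrict_of_subset hQrQ hae] with w hw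
      have hw' : uncurry u w = uncurry V w := hw
      simp [hw']
    have h := norm_le_of_ae_le_of_continuousOn (K := 0) (isOpen_parabolicCylinder r z)
      (hucont.sub hVcont) hae'
    intro w hw
    have h0 : ‖(uncurry u - uncurry V) w‖ ≤ 0 := h w hw
    have h1 : uncurry u w - uncurry V w = 0 := norm_le_zero_iff.1 h0
    have h2 : uncurry u w = uncurry V w := sub_eq_zero.1 h1
    exact h2.symm
  -- ### the Hölder bound in time for `u`
  refine ⟨Cf 0 r, αf 0 r, NNReal.coe_nonneg _, by exact_mod_cast hα0, fun t ht s hs x hx => ?_⟩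
  have hw1 : ((t, x) : ℝ × EuclideanSpace ℝ (Fin 3)) ∈ parabolicCylinder r z := by
    rw [hQr]; exact ⟨ht, hx⟩
  have hw2 : ((s, x) : ℝ × EuclideanSpace ℝ (Fin 3)) ∈ parabolicCylinder r z := by
    rw [hQr]; exact ⟨hs, hx⟩
  have h := hHolder.dist_le hw1 hw2
  rw [dist_iteratedFDeriv_zero] at h
  have e1 : V t x = u t x := hVu _ hw1
  have e2 : V s x = u s x := hVu _ hw2
  have hd : dist ((t, x) : ℝ × EuclideanSpace ℝ (Fin 3)) (s, x) = |t - s| := by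
    rw [Prod.dist_eq, dist_self, Real.dist_eq, max_eq_left (abs_nonneg _)]
  have h' : dist (V t x) (V s x) ≤ (Cf 0 r : ℝ) * dist ((t, x) : ℝ × EuclideanSpace ℝ (Fin 3)) (s, x)
      ^ (αf 0 r : ℝ) := h
  rw [e1, e2, hd, dist_eq_norm] at h'
  exact h'

/-! ### The final datum near a regular point -/

/-- **NEAR A REGULAR POINT THE FINAL DATUM IS A CONTINUOUS FIELD, ATTAINED UNIFORMLY AT A HÖLDER
RATE, AND IT IS THE TRACE.** Let `u ∈ 𝒟_{C,K}` and let `a` be a point at which the crux's singular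
clause fails. Then there are `r > 0`, a field `U₀` continuous on `B(a, r)`, and `M ≥ 0`, `α > 0`
with `‖u(t, x) − U₀(x)‖ ≤ M (−t)^α` for all `t ∈ (−r², 0)`, `x ∈ B(a, r)`, and
`∫⟪u(t), ψ⟫ → ∫⟪U₀, ψ⟫` as `t → 0⁻` for every test field `ψ` supported in `B(a, r)` — so the
distributional trace of lead g3 is, near `a`, the continuous field `U₀`. -/
theorem exists_finalDatum_near_regular (hu : IsTypeIAncientMild C u)
    (hlaw : ∀ s : ℝ, s < 0 → ∫⁻ x, ‖fderiv ℝ (u s) x‖ₑ ^ 2 ≤ ENNReal.ofReal (K / Real.sqrt (-s)))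
    {a : EuclideanSpace ℝ (Fin 3)}
    (ha : ¬ (∀ ρ > 0, ∀ M : ℝ, ∃ t ∈ Ioo (-(ρ ^ 2)) (0 : ℝ), ∃ x ∈ ball a ρ, M < ‖u t x‖)) :
    ∃ (r : ℝ) (U₀ : EuclideanSpace ℝ (Fin 3) → EuclideanSpace ℝ (Fin 3)) (M α : ℝ),
      0 < r ∧ 0 ≤ M ∧ 0 < α ∧ ContinuousOn U₀ (ball a r) ∧
      (∀ t ∈ Ioo (-(r ^ 2)) (0 : ℝ), ∀ x ∈ ball a r, ‖u t x - U₀ x‖ ≤ M * (-t) ^ α) ∧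
      ∀ ψ : EuclideanSpace ℝ (Fin 3) → EuclideanSpace ℝ (Fin 3),
        FunctionSpaces.IsTestFunctionOn (⊤ : Opens (EuclideanSpace ℝ (Fin 3))) ψ →
        (∀ x, ψ x ≠ 0 → ‖x - a‖ < r / 2) →
        Tendsto (fun t => ∫ x, ⟪u t x, ψ x⟫) (𝓝[<] 0) (𝓝 (∫ x, ⟪U₀ x, ψ x⟫)) := by
  -- ### a bounded backward cylinder at `a`
  push Not at ha
  obtain ⟨ρ, hρ, B, hB⟩ := ha
  obtain ⟨M, α, hM0, hα, hHol⟩ := exists_holder_time_near_regular hu hlaw hρ hB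
  set r : ℝ := ρ / 2 with hr
  have hr0 : 0 < r := by positivity
  -- ### the sequence of times `t_n = -(r²/2)/(n+1)` and the pointwise limit
  set tn : ℕ → ℝ := fun n => -(r ^ 2 / 2) / ((n : ℝ) + 1) with htn
  have htn_apply : ∀ n, tn n = -((r ^ 2 / 2) / ((n : ℝ) + 1)) := fun n => by
    show -(r ^ 2 / 2) / ((n : ℝ) + 1) = _
    ring
  have htn_mem : ∀ n, tn n ∈ Ioo (-(r ^ 2)) (0 : ℝ) := by
    intro n
    have h1 : (0 : ℝ) < (n : ℝ) + 1 := by positivity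
    have hq : 0 < (r ^ 2 / 2) / ((n : ℝ) + 1) := by positivity
    have hq' : (r ^ 2 / 2) / ((n : ℝ) + 1) ≤ r ^ 2 / 2 :=
      div_le_self (by positivity) (by linarith [(Nat.cast_nonneg n : (0 : ℝ) ≤ n)])
    rw [htn_apply]
    refine ⟨?_, ?_⟩
    · nlinarith [pow_pos hr0 2]
    · linarith
  have htn_lim : Tendsto tn atTop (𝓝 0) :=
    tendsto_const_nhds.div_atTop (tendsto_atTop_add_const_right _ _ tendsto_natCast_atTop_atTop)
  have htn_abs : ∀ n, |tn n| ≤ r ^ 2 := fun n => by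
    have h := htn_mem n
    rw [abs_of_neg h.2]
    linarith [h.1]
  -- the values `u (tn n) x` form a Cauchy sequence for `x ∈ B(a, r)`
  have hcauchy : ∀ x ∈ ball a r, CauchySeq fun n => u (tn n) x := by
    intro x hx
    rw [Metric.cauchySeq_iff']
    intro ε hε
    -- `M |tn N|^α < ε` for large `N`
    have hsmall : Tendsto (fun n => M * |tn n| ^ α) atTop (𝓝 0) := by
      have h1 : Tendsto (fun n => |tn n|) atTop (𝓝 0) := by
        simpa using htn_lim.abs
      have h2 : Tendsto (fun n => |tn n| ^ α) atTop (𝓝 0) := by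
        have h3 := h1.rpow_const (p := α) (Or.inr hα.le)
        rwa [Real.zero_rpow hα.ne'] at h3
      simpa using h2.const_mul M
    obtain ⟨N, hN⟩ := (Metric.tendsto_atTop.1 hsmall) ε hε
    refine ⟨N, fun n hn => ?_⟩
    rw [dist_eq_norm]
    have h := hHol (tn n) (htn_mem n) (tn N) (htn_mem N) x hx
    -- `|tn n - tn N| ≤ |tn N|` since both lie in `[tn N, 0)` for `n ≥ N`
    have hmono : tn N ≤ tn n := by
      rw [htn]
      simp only [neg_div]
      rw [neg_le_neg_iff]
      apply div_le_div_of_nonneg_left (by positivity) (by positivity)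
      have : (N : ℝ) ≤ n := by exact_mod_cast hn
      linarith
    have hdiff : |tn n - tn N| ≤ |tn N| := by
      rw [abs_of_nonneg (sub_nonneg.2 hmono), abs_of_neg (htn_mem N).2]
      linarith [(htn_mem n).2]
    have hNε := hN N le_rfl
    rw [Real.dist_eq, sub_zero, abs_of_nonneg (by positivity)] at hNε
    calc ‖u (tn n) x - u (tn N) x‖ ≤ M * |tn n - tn N| ^ α := h
      _ ≤ M * |tn N| ^ α := by
          refine mul_le_mul_of_nonneg_left (Real.rpow_le_rpow (abs_nonneg _) hdiff hα.le) hM0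
      _ < ε := hNε
  -- the limit field `U₀`
  have hlim : ∀ x ∈ ball a r, ∃ v, Tendsto (fun n => u (tn n) x) atTop (𝓝 v) := fun x hx =>
    cauchySeq_tendsto_of_complete (hcauchy x hx)
  classical
  set U₀ : EuclideanSpace ℝ (Fin 3) → EuclideanSpace ℝ (Fin 3) := fun x =>
    if hx : x ∈ ball a r then (hlim x hx).choose else 0 with hU₀
  have hU₀ : ∀ x ∈ ball a r, Tendsto (fun n => u (tn n) x) atTop (𝓝 (U₀ x)) := by
    intro x hx
    simp only [hU₀, dif_pos hx]
    exact (hlim x hx).choose_spec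
  -- ### the uniform modulus `‖u t x - U₀ x‖ ≤ M (-t)^α`
  have hmod : ∀ t ∈ Ioo (-(r ^ 2)) (0 : ℝ), ∀ x ∈ ball a r, ‖u t x - U₀ x‖ ≤ M * (-t) ^ α := by
    intro t ht x hx
    have hconv : Tendsto (fun n => ‖u t x - u (tn n) x‖) atTop (𝓝 ‖u t x - U₀ x‖) :=
      (tendsto_const_nhds.sub (hU₀ x hx)).norm
    have hbound : Tendsto (fun n => M * |t - tn n| ^ α) atTop (𝓝 (M * (-t) ^ α)) := by
      have h1 : Tendsto (fun n => |t - tn n|) atTop (𝓝 (|t - 0|)) :=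
        (continuous_abs.tendsto _).comp (tendsto_const_nhds.sub htn_lim)
      rw [sub_zero, abs_of_neg ht.2] at h1
      have h2 := h1.rpow_const (p := α) (Or.inr hα.le)
      exact h2.const_mul M
    exact le_of_tendsto_of_tendsto' hconv hbound fun n => hHol t ht (tn n) (htn_mem n) x hx
  -- ### continuity of `U₀` on the ball (uniform limit of continuous slices)
  have hU₀cont : ContinuousOn U₀ (ball a r) := by
    refine TendstoUniformlyOn.continuousOn (F := fun n x => u (tn n) x) (p := (atTop : Filter ℕ))
      (tendstoUniformlyOn_iff.2 fun ε hε => ?_)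
      (Frequently.of_forall fun n => ((hu.continuous_slice (htn_mem n).2).continuousOn))
    have hsmall : Tendsto (fun n => M * (-tn n) ^ α) atTop (𝓝 0) := by
      have h1 : Tendsto (fun n => -tn n) atTop (𝓝 0) := by simpa using htn_lim.neg
      have h2 : Tendsto (fun n => (-tn n) ^ α) atTop (𝓝 0) := by
        have h3 := h1.rpow_const (p := α) (Or.inr hα.le)
        rwa [Real.zero_rpow hα.ne'] at h3
      simpa using h2.const_mul M
    obtain ⟨N, hN⟩ := (Metric.tendsto_atTop.1 hsmall) ε hε
    refine eventually_atTop.2 ⟨N, fun n hn x hx => ?_⟩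
    have h := hmod (tn n) (htn_mem n) x hx
    have hNε := hN n hn
    rw [Real.dist_eq, sub_zero, abs_of_nonneg (by
      exact mul_nonneg hM0 (Real.rpow_nonneg (neg_nonneg.2 (htn_mem n).2.le) _))] at hNε
    rw [dist_comm, dist_eq_norm]
    exact lt_of_le_of_lt h hNε
  -- ### the trace near `a` is `U₀`
  refine ⟨r, U₀, M, α, hr0, hM0, hα, hU₀cont, hmod, fun ψ hψ hsupp => ?_⟩
  have hcψ : Continuous ψ := hψ.contDiff.continuous
  have hψcs : HasCompactSupport ψ := hψ.hasCompactSupport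
  have hψ0 : ∀ x, x ∉ ball a r → ψ x = 0 := fun x hx => by
    by_contra h
    have h1 := hsupp x h
    exact hx (by rw [mem_ball, dist_eq_norm]; linarith)
  -- integrability of `⟪U₀, ψ⟫`: continuous on the closed ball `B̄(a, r/2)`, zero outside
  have hK : IsCompact (closedBall a (r / 2)) := isCompact_closedBall _ _
  have hsubK : closedBall a (r / 2) ⊆ ball a r := closedBall_subset_ball (by linarith)
  have hint0 : Integrable (fun x => ⟪U₀ x, ψ x⟫) := by
    have hon : ContinuousOn (fun x => ⟪U₀ x, ψ x⟫) (closedBall a (r / 2)) :=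
      (hU₀cont.mono hsubK).inner hcψ.continuousOn
    refine (hon.integrableOn_compact hK).integrable_of_forall_notMem_eq_zero fun x hx => ?_
    have : ψ x = 0 := by
      by_contra h
      have h1 := hsupp x h
      exact hx (by rw [mem_closedBall, dist_eq_norm]; linarith)
    rw [this, inner_zero_right]
  rw [Metric.tendsto_nhdsWithin_nhds]
  intro ε hε
  set I : ℝ := ∫ x, ‖ψ x‖ with hI
  have hI0 : 0 ≤ I := integral_nonneg fun _ => norm_nonneg _
  -- choose `δ` with `M δ^α (I+1) < ε` and `δ ≤ r²`
  have hsmall : Tendsto (fun s : ℝ => M * s ^ α * (I + 1)) (𝓝[>] 0) (𝓝 0) := by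
    have h1 : Tendsto (fun s : ℝ => s ^ α) (𝓝[>] 0) (𝓝 0) := by
      have h0 : Tendsto (fun s : ℝ => s) (𝓝[>] (0 : ℝ)) (𝓝 0) :=
        (continuous_id.tendsto (0 : ℝ)).mono_left nhdsWithin_le_nhds
      have h2 := h0.rpow_const (p := α) (Or.inr hα.le)
      simpa [Real.zero_rpow hα.ne'] using h2
    simpa using (h1.const_mul M).mul_const (I + 1)
  have hev : ∀ᶠ s in 𝓝[>] (0 : ℝ), M * s ^ α * (I + 1) < ε := hsmall (gt_mem_nhds hε)
  obtain ⟨δ₁, hδ₁, hδ₁ε⟩ := (mem_nhdsGT_iff_exists_Ioo_subset.1 hev)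
  set δ : ℝ := min (δ₁ / 2) (r ^ 2) with hδ
  have hδ0 : 0 < δ := lt_min (half_pos hδ₁) (pow_pos hr0 2)
  refine ⟨δ, hδ0, fun t ht hdist => ?_⟩
  have ht0 : t < 0 := ht
  have htδ : -δ < t := by
    rw [Real.dist_eq, sub_zero, abs_of_neg ht0] at hdist
    linarith
  have htI : t ∈ Ioo (-(r ^ 2)) (0 : ℝ) := ⟨by linarith [min_le_right (δ₁ / 2) (r ^ 2)], ht0⟩
  -- `|∫⟪u t, ψ⟫ - ∫⟪U₀, ψ⟫| ≤ M (-t)^α ∫‖ψ‖`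
  have hint1 : Integrable (fun x => ⟪u t x, ψ x⟫) :=
    integrable_inner_of_continuous_of_hasCompactSupport (hu.continuous_slice ht0) hcψ hψcs
  have hint2 : Integrable (fun x => M * (-t) ^ α * ‖ψ x‖) :=
    (hcψ.norm.integrable_of_hasCompactSupport hψcs.norm).const_mul _
  rw [Real.dist_eq, ← integral_sub hint1 hint0]
  have e : (fun x => ⟪u t x, ψ x⟫ - ⟪U₀ x, ψ x⟫) = fun x => ⟪u t x - U₀ x, ψ x⟫ := by
    funext x; rw [inner_sub_left]
  rw [e]
  have hle : |∫ x, ⟪u t x - U₀ x, ψ x⟫| ≤ ∫ x, M * (-t) ^ α * ‖ψ x‖ := by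
    rw [← Real.norm_eq_abs]
    refine (norm_integral_le_integral_norm _).trans (integral_mono_of_nonneg
      (ae_of_all _ fun x => norm_nonneg _) hint2 (ae_of_all _ fun x => ?_))
    by_cases hx : x ∈ ball a r
    · exact (norm_inner_le_norm _ _).trans
        (mul_le_mul_of_nonneg_right (hmod t htI x hx) (norm_nonneg _))
    · simp [hψ0 x hx]
  rw [integral_const_mul] at hle
  refine lt_of_le_of_lt hle ?_
  have htpos : 0 < -t := neg_pos.2 ht0
  have htδ₁ : -t ∈ Ioo 0 δ₁ := ⟨htpos, by linarith [min_le_left (δ₁ / 2) (r ^ 2)]⟩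
  have h := hδ₁ε htδ₁
  have hMt : 0 ≤ M * (-t) ^ α := mul_nonneg hM0 (Real.rpow_nonneg htpos.le _)
  calc M * (-t) ^ α * I ≤ M * (-t) ^ α * (I + 1) := by nlinarith
    _ < ε := h

end Summit.NavierStokesRegularity.NavierStokesRegularity.Theorems.FiniteDissipationLiouville.Birth.Apex

end
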